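import Summits.CriticalPhenomena.PercolationContinuityZ3.Theorems.PercNearOneGluingNoHeavyLowerTailSahiOneStepProfileGridChainRule
import HarnessLib

/-!
# THE PROFILE-GRID THEOREM for `B = (AND-box) ∩ (OR of coordinate thresholds)` — `(2′)` against ANDs of block thresholds

Prover prim-ineq-prove-3 gen 45 (`--supports stmt-CriticalPhenomena-4575`; memo
`run/shared/lean/prim/prim-ineq-prove-3/PROOF-G45-CHAIN-RULE.md`).  Second file after `…ProfileGridChainRule`.

**`gridK_boxOr_nonneg` / `grid_osN_andOr_nonneg`.**  On a finite product of `PF₂` chains `Π_j {0,…,N}` (independent log-concave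
block counts `φ_j`), with the Hamming slot `H = {Σ_j v_j ≥ t}`, for every numerator `u` with the one-coordinate cross inequalities
(`u = a·Φ`, `a` non-decreasing) and `B = {∀ i, c_i ≤ v_i} ∩ {∃ j, r_j ≤ v_j}`:  the one-step functional `n(a, 1_B)` is `≥ 0`.
PROOF (the CHAIN RULE, `…ProfileGridChainRule`): induction on the set `I` of active AND-constraints.  `I = ∅` is the gen-44 theorem
`grid_osN_nonneg` (in homogeneous form `gridK_or_nonneg`, so that no normalisation is needed later).  Step `I → insert i I`:
condition on the cylinder `U₁ = {c_i ≤ v_i}` — the restricted weight `Φ·1_{U₁}` is the product weight of `φ` with `φ_i` zeroed below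
`c_i` (again `PF₂`), the restricted numerator keeps the cross inequalities, so the induction hypothesis applies to it; the single
threshold `U₁` is an OR of one coordinate threshold (gen 44 again); the three Harris inequalities hold on a product of chains; and
`gridK_step` (= `chainRule_arith` in the twelve cell masses) assembles `(2′)` for `B = U₁ ∩ B'`.
Corollaries: the normalised five-term shape `grid_osN_andOr_nonneg` (consumed by the cube theorem `…SahiOneStepDisjointAndOr`) and the
up-set form `gridK_boxOr_nonneg_of_isUpperSet` (the AND-of-thresholds case of CONJECTURE `G_d` for log-concave chains).
No definitions, no sorries.
-/

noncomputable section

namespace Summit.CriticalPhenomena.PercolationContinuityZ3.Theorems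

namespace SahiOneStep

namespace ProfileGrid

open Finset Function
open Literature.Probability.Distributions (IsLogConcaveSeq piWeight blockSum)
open scoped Classical

variable {κ : Type*} [Fintype κ] [DecidableEq κ] {N : ℕ}

/-! ## The chain-rule step on the grid -/

section Step

/-- **THE CHAIN-RULE STEP on a product of chains.**  Let `w = Π φ_j` (`φ_j ≥ 0`), `u = a·w` with `a` non-decreasing and
`0 ≤ u ≤ w`, `P₁` an increasing event whose restriction `w' = w·1_{P₁}` is again a product weight `Π φ'_j`, `B'` increasing and
`B = P₁ ∩ B'`.  If `K̃(w,u;P₁) ≥ 0` and `K̃(w',u1_{P₁};B') ≥ 0` then `K̃(w,u;B) ≥ 0`. [this work] -/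
theorem gridK_step {φ φ' : κ → ℕ → ℝ} (hφ0 : ∀ j n, 0 ≤ φ j n) (hφ'0 : ∀ j n, 0 ≤ φ' j n) (t : ℕ)
    {u a : (κ → Fin (N + 1)) → ℝ} (ha : Monotone a) (hua : ∀ v, u v = a v * piWeight N φ v)
    (hu0 : ∀ v, 0 ≤ u v) (huΦ : ∀ v, u v ≤ piWeight N φ v)
    (P₁ B' B : (κ → Fin (N + 1)) → Prop) [DecidablePred P₁] [DecidablePred B'] [DecidablePred B]
    (hP₁ : ∀ v v', v ≤ v' → P₁ v → P₁ v') (hB' : ∀ v v', v ≤ v' → B' v → B' v') (hB : ∀ v, B v ↔ P₁ v ∧ B' v)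
    (hw' : ∀ v, piWeight N φ' v = if P₁ v then piWeight N φ v else 0)
    (hsingle : 0 ≤ (∑ v, piWeight N φ v) * (∑ v, if ¬ t ≤ blockSum univ v then piWeight N φ v else 0) * (∑ v, if t ≤ blockSum univ v ∧ P₁ v then u v else 0)
        + (∑ v, piWeight N φ v) * (∑ v, if ¬ t ≤ blockSum univ v then u v else 0) * (∑ v, if P₁ v ∧ ¬ t ≤ blockSum univ v then piWeight N φ v else 0)
        - (∑ v, if ¬ t ≤ blockSum univ v then piWeight N φ v else 0) * (∑ v, u v) * (∑ v, if P₁ v then piWeight N φ v else 0))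
    (hIH : 0 ≤ (∑ v, piWeight N φ' v) * (∑ v, if ¬ t ≤ blockSum univ v then piWeight N φ' v else 0) * (∑ v, if t ≤ blockSum univ v ∧ B' v then (if P₁ v then u v else 0) else 0)
        + (∑ v, piWeight N φ' v) * (∑ v, if ¬ t ≤ blockSum univ v then (if P₁ v then u v else 0) else 0) * (∑ v, if B' v ∧ ¬ t ≤ blockSum univ v then piWeight N φ' v else 0)
        - (∑ v, if ¬ t ≤ blockSum univ v then piWeight N φ' v else 0) * (∑ v, (if P₁ v then u v else 0)) * (∑ v, if B' v then piWeight N φ' v else 0)) :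
    0 ≤ (∑ v, piWeight N φ v) * (∑ v, if ¬ t ≤ blockSum univ v then piWeight N φ v else 0) * (∑ v, if t ≤ blockSum univ v ∧ B v then u v else 0)
        + (∑ v, piWeight N φ v) * (∑ v, if ¬ t ≤ blockSum univ v then u v else 0) * (∑ v, if B v ∧ ¬ t ≤ blockSum univ v then piWeight N φ v else 0)
        - (∑ v, if ¬ t ≤ blockSum univ v then piWeight N φ v else 0) * (∑ v, u v) * (∑ v, if B v then piWeight N φ v else 0) := by
  have hw0 : ∀ v, 0 ≤ piWeight N φ v := fun v => piWeight_nonneg hφ0 v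
  have hBmono : ∀ v v', v ≤ v' → B v → B v' := fun v v' h hv =>
    (hB v').2 ⟨hP₁ v v' h ((hB v).1 hv).1, hB' v v' h ((hB v).1 hv).2⟩
  -- Harris facts
  have h3 := harris_numerator hφ0 ha hua hP₁
  have h5 := harris_numerator hφ0 ha hua hBmono
  have h4 := harris_events hφ'0 (slot_upper (N := N) t) hB'
  simp only [hw'] at h4
  simp only [hw'] at hIH
  -- relations between the sums (pointwise)
  have R1 : (∑ v, if t ≤ blockSum univ v ∧ B v then u v else 0) =
      (∑ v, if B v then u v else 0) - ∑ v, if B v ∧ ¬ t ≤ blockSum univ v then u v else 0 := by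
    rw [eq_sub_iff_add_eq, ← sum_add_distrib]
    exact Fintype.sum_congr _ _ fun v => by
      by_cases h1 : t ≤ blockSum univ v <;> by_cases h2 : B v <;> simp [h1, h2]
  have R2 : (∑ v, if t ≤ blockSum univ v ∧ P₁ v then u v else 0) =
      (∑ v, if P₁ v then u v else 0) - ∑ v, if P₁ v ∧ ¬ t ≤ blockSum univ v then u v else 0 := by
    rw [eq_sub_iff_add_eq, ← sum_add_distrib]
    exact Fintype.sum_congr _ _ fun v => by
      by_cases h1 : t ≤ blockSum univ v <;> by_cases h2 : P₁ v <;> simp [h1, h2]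
  have R4 : (∑ v, if ¬ t ≤ blockSum univ v then (if P₁ v then piWeight N φ v else 0) else 0) =
      ∑ v, if P₁ v ∧ ¬ t ≤ blockSum univ v then piWeight N φ v else 0 :=
    Fintype.sum_congr _ _ fun v => by
      by_cases h1 : t ≤ blockSum univ v <;> by_cases h2 : P₁ v <;> simp [h1, h2]
  have R5 : (∑ v, if t ≤ blockSum univ v ∧ B' v then (if P₁ v then u v else 0) else 0) =
      (∑ v, if B v then u v else 0) - ∑ v, if B v ∧ ¬ t ≤ blockSum univ v then u v else 0 := by
    rw [eq_sub_iff_add_eq, ← sum_add_distrib]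
    exact Fintype.sum_congr _ _ fun v => by
      by_cases h1 : t ≤ blockSum univ v <;> by_cases h2 : P₁ v <;> by_cases h3' : B' v <;> simp [h1, h2, h3', hB v]
  have R6 : (∑ v, if ¬ t ≤ blockSum univ v then (if P₁ v then u v else 0) else 0) =
      ∑ v, if P₁ v ∧ ¬ t ≤ blockSum univ v then u v else 0 :=
    Fintype.sum_congr _ _ fun v => by
      by_cases h1 : t ≤ blockSum univ v <;> by_cases h2 : P₁ v <;> simp [h1, h2]
  have R7 : (∑ v, if B' v ∧ ¬ t ≤ blockSum univ v then (if P₁ v then piWeight N φ v else 0) else 0) =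
      ∑ v, if B v ∧ ¬ t ≤ blockSum univ v then piWeight N φ v else 0 :=
    Fintype.sum_congr _ _ fun v => by
      by_cases h1 : t ≤ blockSum univ v <;> by_cases h2 : P₁ v <;> by_cases h3' : B' v <;> simp [h1, h2, h3', hB v]
  have R9 : (∑ v, if B' v then (if P₁ v then piWeight N φ v else 0) else 0) = ∑ v, if B v then piWeight N φ v else 0 :=
    Fintype.sum_congr _ _ fun v => by
      by_cases h2 : P₁ v <;> by_cases h3' : B' v <;> simp [h2, h3', hB v]
  have R10 : (∑ v, if t ≤ blockSum univ v then (if P₁ v then piWeight N φ v else 0) else 0) =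
      (∑ v, if P₁ v then piWeight N φ v else 0) - ∑ v, if P₁ v ∧ ¬ t ≤ blockSum univ v then piWeight N φ v else 0 := by
    rw [eq_sub_iff_add_eq, ← sum_add_distrib]
    exact Fintype.sum_congr _ _ fun v => by
      by_cases h1 : t ≤ blockSum univ v <;> by_cases h2 : P₁ v <;> simp [h1, h2]
  have R11 : (∑ v, if t ≤ blockSum univ v ∧ B' v then (if P₁ v then piWeight N φ v else 0) else 0) =
      (∑ v, if B v then piWeight N φ v else 0) - ∑ v, if B v ∧ ¬ t ≤ blockSum univ v then piWeight N φ v else 0 := by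
    rw [eq_sub_iff_add_eq, ← sum_add_distrib]
    exact Fintype.sum_congr _ _ fun v => by
      by_cases h1 : t ≤ blockSum univ v <;> by_cases h2 : P₁ v <;> by_cases h3' : B' v <;> simp [h1, h2, h3', hB v]
  rw [R1]
  rw [R2] at hsingle
  rw [R4, R5, R6, R7, R9] at hIH
  rw [R10, R9, R11] at h4
  -- side facts
  have sM : 0 ≤ ∑ v, piWeight N φ v := sum_nonneg fun v _ => hw0 v
  have sl : 0 ≤ ∑ v, if ¬ t ≤ blockSum univ v then piWeight N φ v else 0 := sum_ite_nonneg' hw0 _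
  have sp1 : 0 ≤ ∑ v, if P₁ v then piWeight N φ v else 0 := sum_ite_nonneg' hw0 _
  have spl1 : 0 ≤ ∑ v, if P₁ v ∧ ¬ t ≤ blockSum univ v then piWeight N φ v else 0 := sum_ite_nonneg' hw0 _
  have spB : 0 ≤ ∑ v, if B v then piWeight N φ v else 0 := sum_ite_nonneg' hw0 _
  have splB : 0 ≤ ∑ v, if B v ∧ ¬ t ≤ blockSum univ v then piWeight N φ v else 0 := sum_ite_nonneg' hw0 _
  have salB : 0 ≤ ∑ v, if B v ∧ ¬ t ≤ blockSum univ v then u v else 0 := sum_ite_nonneg' hu0 _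
  have salBplB : (∑ v, if B v ∧ ¬ t ≤ blockSum univ v then u v else 0) ≤
      ∑ v, if B v ∧ ¬ t ≤ blockSum univ v then piWeight N φ v else 0 := sum_ite_le_of_le huΦ _
  have splBpB : (∑ v, if B v ∧ ¬ t ≤ blockSum univ v then piWeight N φ v else 0) ≤
      ∑ v, if B v then piWeight N φ v else 0 := sum_ite_le_of_imp hw0 fun v hv => hv.1
  have spBp1 : (∑ v, if B v then piWeight N φ v else 0) ≤ ∑ v, if P₁ v then piWeight N φ v else 0 :=
    sum_ite_le_of_imp hw0 fun v hv => ((hB v).1 hv).1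
  -- generalize the twelve atoms and conclude with the arithmetic chain rule
  generalize (∑ v, piWeight N φ v) = M at *
  generalize (∑ v, if ¬ t ≤ blockSum univ v then piWeight N φ v else 0) = l at *
  generalize (∑ v, u v) = a₀ at *
  generalize (∑ v, if ¬ t ≤ blockSum univ v then u v else 0) = al at *
  generalize (∑ v, if P₁ v then piWeight N φ v else 0) = p1 at *
  generalize (∑ v, if P₁ v ∧ ¬ t ≤ blockSum univ v then piWeight N φ v else 0) = pl1 at *
  generalize (∑ v, if P₁ v then u v else 0) = a1 at *
  generalize (∑ v, if P₁ v ∧ ¬ t ≤ blockSum univ v then u v else 0) = al1 at *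
  generalize (∑ v, if B v then piWeight N φ v else 0) = pB at *
  generalize (∑ v, if B v ∧ ¬ t ≤ blockSum univ v then piWeight N φ v else 0) = plB at *
  generalize (∑ v, if B v then u v else 0) = aB at *
  generalize (∑ v, if B v ∧ ¬ t ≤ blockSum univ v then u v else 0) = alB at *
  exact chainRule_arith sM sl sp1 spl1 spB splB salB salBplB splBpB spBp1 hsingle hIH (by linarith) (by linarith)
    (by linarith)

end Step

/-! ## The base case: the gen-44 grid theorem in homogeneous form (no normalisation) -/

section Base

/-- **The gen-44 grid theorem, homogeneous form.**  For `PF₂` weights `φ_j` (not necessarily normalised) and a numerator `u`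
with `0 ≤ u ≤ Φ` and the one-coordinate cross inequalities: `K̃(Φ, u; {∃ j, r_j ≤ v_j}) ≥ 0`. [this work] -/
theorem gridK_or_nonneg (φ : κ → ℕ → ℝ) (hφ : ∀ j, IsLogConcaveSeq (φ j)) (r : κ → ℕ) (t : ℕ)
    (u : (κ → Fin (N + 1)) → ℝ) (hu0 : ∀ v, 0 ≤ u v) (huΦ : ∀ v, u v ≤ piWeight N φ v)
    (hmono : ∀ v j (x x' : Fin (N + 1)), x ≤ x' → u (update v j x) * φ j x' ≤ u (update v j x') * φ j x) :
    0 ≤ (∑ v, piWeight N φ v) * (∑ v, if ¬ t ≤ blockSum univ v then piWeight N φ v else 0) * (∑ v, if t ≤ blockSum univ v ∧ (∃ j, r j ≤ (v j : ℕ)) then u v else 0)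
        + (∑ v, piWeight N φ v) * (∑ v, if ¬ t ≤ blockSum univ v then u v else 0) * (∑ v, if (∃ j, r j ≤ (v j : ℕ)) ∧ ¬ t ≤ blockSum univ v then piWeight N φ v else 0)
        - (∑ v, if ¬ t ≤ blockSum univ v then piWeight N φ v else 0) * (∑ v, u v) * (∑ v, if (∃ j, r j ≤ (v j : ℕ)) then piWeight N φ v else 0) := by
  have hφ0 : ∀ j n, 0 ≤ φ j n := fun j => (hφ j).1
  set Z : κ → ℝ := fun j => ∑ n : Fin (N + 1), φ j n with hZ
  have hZ0 : ∀ j, 0 ≤ Z j := fun j => sum_nonneg fun n _ => hφ0 j n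
  by_cases hdeg : ∃ j, Z j = 0
  · -- a null factor: `Φ ≡ 0`, `u ≡ 0`, everything vanishes
    obtain ⟨j, hj⟩ := hdeg
    have hφj : ∀ n : Fin (N + 1), φ j n = 0 := fun n =>
      (sum_eq_zero_iff_of_nonneg (s := (univ : Finset (Fin (N + 1)))) (f := fun n : Fin (N + 1) => φ j n)
        (fun n _ => hφ0 j n)).1 hj n (mem_univ n)
    have hw : ∀ v, piWeight N φ v = 0 := fun v => by
      rw [piWeight_eq_mul_erase φ j, hφj, zero_mul]
    have hu : ∀ v, u v = 0 := fun v => le_antisymm ((huΦ v).trans (hw v).le) (hu0 v)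
    simp only [hw, hu, ite_self, sum_const_zero, mul_zero, sub_zero, add_zero, le_refl]
  · push Not at hdeg
    have hZpos : ∀ j, 0 < Z j := fun j => lt_of_le_of_ne (hZ0 j) (hdeg j).symm
    -- normalise
    set φn : κ → ℕ → ℝ := fun j n => (Z j)⁻¹ * φ j n with hφn
    set cst : ℝ := ∏ j, (Z j)⁻¹ with hcst
    have hcst : 0 < cst := prod_pos fun j _ => inv_pos.2 (hZpos j)
    have hφn_lc : ∀ j, IsLogConcaveSeq (φn j) := fun j => (hφ j).const_mul (inv_pos.2 (hZpos j)).le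
    have hφn1 : ∀ j, ∑ n : Fin (N + 1), φn j n = 1 := fun j => by
      simp only [hφn]; rw [← mul_sum]; exact inv_mul_cancel₀ (hdeg j)
    have hwn : ∀ v, piWeight N φn v = cst * piWeight N φ v := fun v => piWeight_const_mul _ φ v
    set un : (κ → Fin (N + 1)) → ℝ := fun v => cst * u v with hun
    have hun0 : ∀ v, 0 ≤ un v := fun v => mul_nonneg hcst.le (hu0 v)
    have hunΦ : ∀ v, un v ≤ piWeight N φn v := fun v => by
      rw [hwn]; exact mul_le_mul_of_nonneg_left (huΦ v) hcst.le
    have hmonon : ∀ v j (x x' : Fin (N + 1)), x ≤ x' →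
        un (update v j x) * φn j x' ≤ un (update v j x') * φn j x := by
      intro v j x x' hxx'
      simp only [hun, hφn]
      have := hmono v j x x' hxx'
      have hc : 0 ≤ cst * (Z j)⁻¹ := mul_nonneg hcst.le (inv_pos.2 (hZpos j)).le
      calc cst * u (update v j x) * ((Z j)⁻¹ * φ j x') = cst * (Z j)⁻¹ * (u (update v j x) * φ j x') := by ring
        _ ≤ cst * (Z j)⁻¹ * (u (update v j x') * φ j x) := mul_le_mul_of_nonneg_left this hc
        _ = cst * u (update v j x') * ((Z j)⁻¹ * φ j x) := by ring
    have hsum1 : ∑ v, piWeight N φn v = 1 := by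
      rw [sum_piWeight_eq_prod, prod_congr rfl fun j _ => hφn1 j]; simp
    have h1 := grid_osN_nonneg φn hφn_lc hφn1 r t un hun0 hunΦ hmonon
    rw [fiveTerm_eq_gridK t (piWeight N φn) un (fun v => ∃ j, r j ≤ (v j : ℕ)) hsum1] at h1
    simp only [hwn, hun] at h1
    have h2 := h1.trans_eq (gridK_smul t cst (piWeight N φ) u (fun v => ∃ j, r j ≤ (v j : ℕ)))
    exact nonneg_of_mul_nonneg_right h2 (pow_pos hcst 3)

end Base

/-! ## THE GRID THEOREM for `B = (AND-box) ∩ (OR of thresholds)` -/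

section Main

/-- **`(2′)` on a product of `PF₂` chains for `B = {∀ i ∈ I, c_i ≤ v_i} ∩ {∃ j, r_j ≤ v_j}`**, homogeneous form, by induction on
`I` (the chain rule; each step conditions on one coordinate cylinder). [this work] -/
theorem gridK_andOr_nonneg (I : Finset κ) : ∀ (φ : κ → ℕ → ℝ), (∀ j, IsLogConcaveSeq (φ j)) →
    ∀ (c r : κ → ℕ) (t : ℕ) (u : (κ → Fin (N + 1)) → ℝ), (∀ v, 0 ≤ u v) → (∀ v, u v ≤ piWeight N φ v) →
    (∀ v j (x x' : Fin (N + 1)), x ≤ x' → u (update v j x) * φ j x' ≤ u (update v j x') * φ j x) →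
    0 ≤ (∑ v, piWeight N φ v) * (∑ v, if ¬ t ≤ blockSum univ v then piWeight N φ v else 0) * (∑ v, if t ≤ blockSum univ v ∧ ((∀ i ∈ I, c i ≤ (v i : ℕ)) ∧ ∃ j, r j ≤ (v j : ℕ)) then u v else 0)
        + (∑ v, piWeight N φ v) * (∑ v, if ¬ t ≤ blockSum univ v then u v else 0) * (∑ v, if ((∀ i ∈ I, c i ≤ (v i : ℕ)) ∧ ∃ j, r j ≤ (v j : ℕ)) ∧ ¬ t ≤ blockSum univ v then piWeight N φ v else 0)
        - (∑ v, if ¬ t ≤ blockSum univ v then piWeight N φ v else 0) * (∑ v, u v) * (∑ v, if ((∀ i ∈ I, c i ≤ (v i : ℕ)) ∧ ∃ j, r j ≤ (v j : ℕ)) then piWeight N φ v else 0) := by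
  induction I using Finset.induction_on with
  | empty =>
    intro φ hφ c r t u hu0 huΦ hmono
    exact (gridK_or_nonneg φ hφ r t u hu0 huΦ hmono).trans_eq (gridK_congr_prop t _ u
      (B := fun v => ∃ j, r j ≤ (v j : ℕ)) (B' := fun v => (∀ i ∈ (∅ : Finset κ), c i ≤ (v i : ℕ)) ∧ ∃ j, r j ≤ (v j : ℕ))
      (fun v => by simp))
  | insert i I hiI IH =>
    intro φ hφ c r t u hu0 huΦ hmono
    have hφ0 : ∀ j n, 0 ≤ φ j n := fun j => (hφ j).1
    obtain ⟨a, ha, -, hua⟩ := exists_monotone_density hφ0 u hu0 huΦ hmono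
    -- the restricted weights and numerator
    set φ' : κ → ℕ → ℝ := update φ i (fun n => if c i ≤ n then φ i n else 0) with hφ'
    have hφ'lc : ∀ j, IsLogConcaveSeq (φ' j) := isLogConcaveSeq_update_truncGE hφ i (c i)
    have hφ'0 : ∀ j n, 0 ≤ φ' j n := fun j => (hφ'lc j).1
    have hw' : ∀ v, piWeight N φ' v = if c i ≤ (v i : ℕ) then piWeight N φ v else 0 :=
      piWeight_update_truncGE φ i (c i)
    have hu'0 : ∀ v, 0 ≤ (if c i ≤ (v i : ℕ) then u v else 0) := fun v => by
      split_ifs <;> [exact hu0 v; exact le_rfl]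
    have hu'Φ : ∀ v, (if c i ≤ (v i : ℕ) then u v else 0) ≤ piWeight N φ' v := fun v => by
      rw [hw']; split_ifs <;> [exact huΦ v; exact le_rfl]
    have hmono' : ∀ v j (x x' : Fin (N + 1)), x ≤ x' →
        (if c i ≤ (update v j x i : ℕ) then u (update v j x) else 0) * φ' j x' ≤
          (if c i ≤ (update v j x' i : ℕ) then u (update v j x') else 0) * φ' j x := by
      intro v j x x' hxx'
      have hnn : 0 ≤ (if c i ≤ (update v j x' i : ℕ) then u (update v j x') else 0) * φ' j x :=
        mul_nonneg (by split_ifs <;> [exact hu0 _; exact le_rfl]) (hφ'0 j _)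
      by_cases hj : j = i
      · subst hj
        simp only [update_self, hφ']
        by_cases hx : c j ≤ (x : ℕ)
        · have hx' : c j ≤ (x' : ℕ) := hx.trans (by exact_mod_cast hxx')
          rw [if_pos hx, if_pos hx', if_pos hx', if_pos hx]; exact hmono v j x x' hxx'
        · rw [if_neg hx, zero_mul, if_neg hx, mul_zero]
      · rw [update_of_ne (Ne.symm hj), update_of_ne (Ne.symm hj)] at *
        simp only [hφ', update_of_ne hj]
        by_cases hv : c i ≤ (v i : ℕ)
        · rw [if_pos hv, if_pos hv]; exact hmono v j x x' hxx'
        · rw [if_neg hv, zero_mul, if_neg hv, zero_mul]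
    have hIH := IH φ' hφ'lc c r t (fun v => if c i ≤ (v i : ℕ) then u v else 0) hu'0 hu'Φ hmono'
    -- the single threshold `{c_i ≤ v_i}` as an OR of thresholds
    have hiff : ∀ v : κ → Fin (N + 1), (∃ j, update (fun _ => N + 1) i (c i) j ≤ (v j : ℕ)) ↔ c i ≤ (v i : ℕ) := by
      intro v
      constructor
      · rintro ⟨j, hj⟩
        by_cases hji : j = i
        · subst hji; rwa [update_self] at hj
        · rw [update_of_ne hji] at hj
          have := (v j).2; omega
      · intro hv; exact ⟨i, by rwa [update_self]⟩
    have hsingle := (gridK_or_nonneg φ hφ (update (fun _ => N + 1) i (c i)) t u hu0 huΦ hmono).trans_eq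
      (gridK_congr_prop t _ u (B' := fun v => c i ≤ (v i : ℕ)) hiff)
    refine gridK_step hφ0 hφ'0 t ha hua hu0 huΦ (fun v => c i ≤ (v i : ℕ))
      (fun v => (∀ i' ∈ I, c i' ≤ (v i' : ℕ)) ∧ ∃ j, r j ≤ (v j : ℕ))
      (fun v => (∀ i' ∈ insert i I, c i' ≤ (v i' : ℕ)) ∧ ∃ j, r j ≤ (v j : ℕ))
      (fun v v' h hv => hv.trans (by exact_mod_cast h i)) (fun v v' h hv => ?_) (fun v => ?_) hw' hsingle hIH
    · exact ⟨fun i' hi' => (hv.1 i' hi').trans (by exact_mod_cast h i'),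
        hv.2.imp fun j hj => hj.trans (by exact_mod_cast h j)⟩
    · simp only [forall_mem_insert, and_assoc]

/-- **THE GRID THEOREM (homogeneous form).**  On a finite product of `PF₂` chains, with the Hamming slot `H = {Σ_j v_j ≥ t}`, for
every numerator `u` with the one-coordinate cross inequalities (`u = a·Φ`, `a` non-decreasing, `0 ≤ a ≤ 1`) and
`B = {∀ i, c_i ≤ v_i} ∩ {∃ j, r_j ≤ v_j}` (an AND-box intersected with an OR of coordinate thresholds): `K̃(Φ, u; B) ≥ 0`. [this work] -/
theorem gridK_boxOr_nonneg (φ : κ → ℕ → ℝ) (hφ : ∀ j, IsLogConcaveSeq (φ j)) (c r : κ → ℕ) (t : ℕ)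
    (u : (κ → Fin (N + 1)) → ℝ) (hu0 : ∀ v, 0 ≤ u v) (huΦ : ∀ v, u v ≤ piWeight N φ v)
    (hmono : ∀ v j (x x' : Fin (N + 1)), x ≤ x' → u (update v j x) * φ j x' ≤ u (update v j x') * φ j x) :
    0 ≤ (∑ v, piWeight N φ v) * (∑ v, if ¬ t ≤ blockSum univ v then piWeight N φ v else 0) * (∑ v, if t ≤ blockSum univ v ∧ ((∀ i, c i ≤ (v i : ℕ)) ∧ ∃ j, r j ≤ (v j : ℕ)) then u v else 0)
        + (∑ v, piWeight N φ v) * (∑ v, if ¬ t ≤ blockSum univ v then u v else 0) * (∑ v, if ((∀ i, c i ≤ (v i : ℕ)) ∧ ∃ j, r j ≤ (v j : ℕ)) ∧ ¬ t ≤ blockSum univ v then piWeight N φ v else 0)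
        - (∑ v, if ¬ t ≤ blockSum univ v then piWeight N φ v else 0) * (∑ v, u v) * (∑ v, if ((∀ i, c i ≤ (v i : ℕ)) ∧ ∃ j, r j ≤ (v j : ℕ)) then piWeight N φ v else 0) :=
  (gridK_andOr_nonneg univ φ hφ c r t u hu0 huΦ hmono).trans_eq (gridK_congr_prop t _ u
    (B := fun v => (∀ i ∈ (univ : Finset κ), c i ≤ (v i : ℕ)) ∧ ∃ j, r j ≤ (v j : ℕ))
    (B' := fun v => (∀ i, c i ≤ (v i : ℕ)) ∧ ∃ j, r j ≤ (v j : ℕ)) (fun v => by simp))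

/-- **THE GRID THEOREM, five-term shape of `osN_ind_ind`** (normalised weights), ready for the cube: `(2′)` on a product of `PF₂`
chains for every monotone density against `B = {∀ i, c_i ≤ v_i} ∩ {∃ j, r_j ≤ v_j}`. [this work] -/
theorem grid_osN_andOr_nonneg (φ : κ → ℕ → ℝ) (hφ : ∀ j, IsLogConcaveSeq (φ j)) (hφ1 : ∀ j, ∑ n : Fin (N + 1), φ j n = 1)
    (c r : κ → ℕ) (t : ℕ) (u : (κ → Fin (N + 1)) → ℝ) (hu0 : ∀ v, 0 ≤ u v) (huΦ : ∀ v, u v ≤ piWeight N φ v)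
    (hmono : ∀ v j (x x' : Fin (N + 1)), x ≤ x' → u (update v j x) * φ j x' ≤ u (update v j x') * φ j x) :
    0 ≤ (∑ v : κ → Fin (N + 1), if t ≤ blockSum univ v then u v else 0) *
          (∑ v : κ → Fin (N + 1), if t ≤ blockSum univ v ∧ ((∀ i, c i ≤ (v i : ℕ)) ∧ ∃ j, r j ≤ (v j : ℕ))
            then piWeight N φ v else 0)
      + (1 - ∑ v : κ → Fin (N + 1), if t ≤ blockSum univ v then piWeight N φ v else 0) *
          (∑ v : κ → Fin (N + 1), if t ≤ blockSum univ v ∧ ((∀ i, c i ≤ (v i : ℕ)) ∧ ∃ j, r j ≤ (v j : ℕ))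
            then u v else 0)
      + (∑ v : κ → Fin (N + 1), if t ≤ blockSum univ v then piWeight N φ v else 0) * (∑ v : κ → Fin (N + 1), u v) *
          (∑ v : κ → Fin (N + 1), if ((∀ i, c i ≤ (v i : ℕ)) ∧ ∃ j, r j ≤ (v j : ℕ)) then piWeight N φ v else 0)
      - (∑ v : κ → Fin (N + 1), if t ≤ blockSum univ v then u v else 0) *
          (∑ v : κ → Fin (N + 1), if ((∀ i, c i ≤ (v i : ℕ)) ∧ ∃ j, r j ≤ (v j : ℕ)) then piWeight N φ v else 0)
      - (∑ v : κ → Fin (N + 1), if t ≤ blockSum univ v ∧ ((∀ i, c i ≤ (v i : ℕ)) ∧ ∃ j, r j ≤ (v j : ℕ))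
            then piWeight N φ v else 0) * (∑ v : κ → Fin (N + 1), u v) := by
  have hsum1 : ∑ v, piWeight N φ v = 1 := by
    rw [sum_piWeight_eq_prod, prod_congr rfl fun j _ => hφ1 j]; simp
  have h := gridK_boxOr_nonneg φ hφ c r t u hu0 huΦ hmono
  rw [← fiveTerm_eq_gridK t (piWeight N φ) u (fun v => (∀ i, c i ≤ (v i : ℕ)) ∧ ∃ j, r j ≤ (v j : ℕ)) hsum1] at h
  exact h

/-- **`(2′)` ON A PRODUCT OF `PF₂` CHAINS for an UP-SET against `B = {∀ i, c_i ≤ v_i} ∩ {∃ j, r_j ≤ v_j}`** — in particular against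
every AND of coordinate thresholds (the AND case of CONJECTURE `G_d` for log-concave chains). [this work] -/
theorem gridK_boxOr_nonneg_of_isUpperSet (φ : κ → ℕ → ℝ) (hφ : ∀ j, IsLogConcaveSeq (φ j)) (c r : κ → ℕ) (t : ℕ)
    {A : Set (κ → Fin (N + 1))} (hA : IsUpperSet A) :
    0 ≤ (∑ v, piWeight N φ v) * (∑ v, if ¬ t ≤ blockSum univ v then piWeight N φ v else 0) * (∑ v, if t ≤ blockSum univ v ∧ ((∀ i, c i ≤ (v i : ℕ)) ∧ ∃ j, r j ≤ (v j : ℕ)) then (if v ∈ A then piWeight N φ v else 0) else 0)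
        + (∑ v, piWeight N φ v) * (∑ v, if ¬ t ≤ blockSum univ v then (if v ∈ A then piWeight N φ v else 0) else 0) * (∑ v, if ((∀ i, c i ≤ (v i : ℕ)) ∧ ∃ j, r j ≤ (v j : ℕ)) ∧ ¬ t ≤ blockSum univ v then piWeight N φ v else 0)
        - (∑ v, if ¬ t ≤ blockSum univ v then piWeight N φ v else 0) * (∑ v, (if v ∈ A then piWeight N φ v else 0)) * (∑ v, if ((∀ i, c i ≤ (v i : ℕ)) ∧ ∃ j, r j ≤ (v j : ℕ)) then piWeight N φ v else 0) := by
  have hφ0 : ∀ j n, 0 ≤ φ j n := fun j => (hφ j).1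
  refine gridK_boxOr_nonneg φ hφ c r t _ (fun v => by split_ifs <;> [exact piWeight_nonneg hφ0 v; exact le_rfl])
    (fun v => by split_ifs <;> [exact le_rfl; exact piWeight_nonneg hφ0 v]) (fun v j x x' hxx' => ?_)
  by_cases hx : update v j x ∈ A
  · have hx' : update v j x' ∈ A := hA (fun i => by
      by_cases hi : i = j
      · subst hi; rw [update_self, update_self]; exact hxx'
      · rw [update_of_ne hi, update_of_ne hi]) hx
    rw [if_pos hx, if_pos hx', piWeight_update, piWeight_update]
    apply le_of_eq; ring
  · rw [if_neg hx, zero_mul]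
    exact mul_nonneg (by split_ifs <;> [exact piWeight_nonneg hφ0 _; exact le_rfl]) (hφ0 j _)

end Main

end ProfileGrid

end SahiOneStep

end Summit.CriticalPhenomena.PercolationContinuityZ3.Theorems
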